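import Mathlib
import Summits.Ventures.PercRepro2.HCov
import Summits.Ventures.PercRepro2.HCovSwap
import Summits.Ventures.PercRepro2.ContractDefs
import Summits.Ventures.PercRepro2.HCovCubic
import Summits.Ventures.PercRepro2.RECMReduction
import Summits.Ventures.PercRepro2.RECMReductionC
import Summits.Ventures.PercRepro2.GcTransport
import Summits.Ventures.PercRepro2.GcTransportMarks
import Summits.Ventures.PercRepro2.GcSeries
import Summits.Ventures.PercRepro2.GcParallel
import Summits.Ventures.PercRepro2.CCWReduction

/-!
# (HCOV) from (c-CW) on the REDUCED class (blind cell PercRepro2, p1 g11; the (root) residual map of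
record, ASSIGNMENTS v12.17 / LEAD-CCW §3⁗, in one weighted Lean statement)

`CCWReduction.lean` reduces (HCOV) to (c-CW) at EVERY unmarked-`y` root edge. The lead's residual
of record restricts (c-CW) to the REDUCED class — root edges `e = {a₁, y}` whose unmarked end `y`
has degree ≥ 3 — because a degree-one `y` is invisible (rule (c)) and a degree-two `y` is a series
cell (rule (a)): there the typed bases are nonnegative combinations of the bases one rung down and
no (c-CW) is needed. This file is the weighted form of that reduction:

* **`otherEdges ends e y`**: the non-loop edges at `y` other than `e`; **`Simple ends`**: no two
  parallel non-loop edges; **`cCWRedS_all c`**: (c-CW) at every root edge `e = {a₁, y}` of every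
  SIMPLE graph with `y` unmarked carrying at least two other non-loop edges (the reduced class of
  the census lists); **`cCWRed_all c`**: the same without the simplicity restriction;
* **`HCov_of_rootEdge`**: at a root edge `e = {a₁, y}` with `y` unmarked, (HCOV) for the graph from
  (HCOV) for every graph with fewer non-loop edges — by the leaf rule (`Gc_leaf`: no other edge at
  `y`), the series rule (`Gc_series`: exactly one other edge), or (c-CW) with the deletion and the
  contraction (`HCov_of_cCWAt`: at least two other edges);
* **`HCov_all_of_cCWRedS_all`**: `0 ≤ c → cCWRedS_all c → HCovR_all → HCov_all` — the strong
  induction on `nonLoopCard` of `CCWReduction.lean`: parallel edges are merged first (`Gc_parallel`),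
  then the two rules or (c-CW) at a root–unmarked edge, else class R. `cCWRedS_all c ⟸ cCWRed_all c
  ⟸ cCW_all c`, so this strictly sharpens `HCov_all_of_cCW_all`: the cell's census value of the
  hypothesis moves from the series-cell record (≤ 1/2 at |F| = 11, p1 g11) to the reduced-class
  record (3/4 at |F| = 10, engine D160), on simple graphs.
-/

namespace Summit.Ventures.PercRepro2

open CovForm Contract

namespace RECM

section Defs

variable {V : Type*} {E : Type*} [Fintype E] [DecidableEq E] [DecidableEq V]

/-- The non-loop edges at `y` other than `e`. -/
def otherEdges (ends : E → Sym2 V) (e : E) (y : V) : Finset E :=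
  Finset.univ.filter fun g => g ≠ e ∧ y ∈ ends g ∧ ¬ (ends g).IsDiag

/-- Membership in `otherEdges`. -/
lemma mem_otherEdges {ends : E → Sym2 V} {e : E} {y : V} {g : E} :
    g ∈ otherEdges ends e y ↔ g ≠ e ∧ y ∈ ends g ∧ ¬ (ends g).IsDiag := by
  simp [otherEdges]

omit [Fintype E] [DecidableEq E] [DecidableEq V] in
/-- **Simple**: no two distinct non-loop edges have the same ends. -/
def Simple (ends : E → Sym2 V) : Prop :=
  ∀ g₁ g₂, g₁ ≠ g₂ → ¬ (ends g₁).IsDiag → ends g₁ ≠ ends g₂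

end Defs

section Closure

variable (R : Type*) [Field R] [LinearOrder R] [IsStrictOrderedRing R]

/-- **Row (c-CW) on the REDUCED class, weighted**: (c-CW) with the constant `c` at every root edge
`e = {a₁, y}` with `y` unmarked of degree at least three (at least two non-loop edges at `y`
besides `e`), on every finite graph with distinct marks and admissible weights. -/
def cCWRed_all (c : R) : Prop :=
  ∀ (V E : Type) [Fintype V] [DecidableEq V] [Fintype E] [DecidableEq E]
    (ends : E → Sym2 V) (p : E → R), IsProbVec p →
    ∀ o a₁ a₂ a₃ b : V, a₁ ≠ a₂ → a₁ ≠ a₃ → a₂ ≠ a₃ → o ≠ a₁ → o ≠ a₂ → o ≠ a₃ → o ≠ b →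
      b ≠ a₁ → b ≠ a₂ → b ≠ a₃ → ∀ (y : V) (e : E), Unmarked o a₁ a₂ a₃ b y → ends e = s(a₁, y) →
        2 ≤ (otherEdges ends e y).card → cCWAt c p ends o a₁ a₂ a₃ b e y

/-- **Row (c-CW) on the REDUCED class of SIMPLE graphs, weighted**: `cCWRed_all` restricted to graphs
without parallel non-loop edges — the reduced class of the cell's census lists. -/
def cCWRedS_all (c : R) : Prop :=
  ∀ (V E : Type) [Fintype V] [DecidableEq V] [Fintype E] [DecidableEq E]
    (ends : E → Sym2 V), Simple ends → ∀ (p : E → R), IsProbVec p →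
    ∀ o a₁ a₂ a₃ b : V, a₁ ≠ a₂ → a₁ ≠ a₃ → a₂ ≠ a₃ → o ≠ a₁ → o ≠ a₂ → o ≠ a₃ → o ≠ b →
      b ≠ a₁ → b ≠ a₂ → b ≠ a₃ → ∀ (y : V) (e : E), Unmarked o a₁ a₂ a₃ b y → ends e = s(a₁, y) →
        2 ≤ (otherEdges ends e y).card → cCWAt c p ends o a₁ a₂ a₃ b e y

variable {R}

omit [IsStrictOrderedRing R] in
/-- (c-CW) everywhere gives (c-CW) on the reduced class. -/
theorem cCWRed_all_of_cCW_all {c : R} (h : cCW_all R c) : cCWRed_all R c :=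
  fun V E _ _ _ _ ends p hp o a₁ a₂ a₃ b h12 h13 h23 ho1 ho2 ho3 hob hb1 hb2 hb3 y e hy he _ =>
    h V E ends p hp o a₁ a₂ a₃ b h12 h13 h23 ho1 ho2 ho3 hob hb1 hb2 hb3 y e hy he

omit [IsStrictOrderedRing R] in
/-- (c-CW) on the reduced class gives (c-CW) on the reduced class of simple graphs. -/
theorem cCWRedS_all_of_cCWRed_all {c : R} (h : cCWRed_all R c) : cCWRedS_all R c :=
  fun V E _ _ _ _ ends _ p hp o a₁ a₂ a₃ b h12 h13 h23 ho1 ho2 ho3 hob hb1 hb2 hb3 y e hy he hd =>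
    h V E ends p hp o a₁ a₂ a₃ b h12 h13 h23 ho1 ho2 ho3 hob hb1 hb2 hb3 y e hy he hd

end Closure

section Main

variable {R : Type*} [Field R] [LinearOrder R] [IsStrictOrderedRing R]

/-- **(HCOV) at a graph with a root edge `e = {a₁, y}` to an unmarked `y`** from (HCOV) for every
graph with fewer non-loop edges: the leaf rule, the series rule, or (c-CW) with the deletion and
the contraction, according to the number of other non-loop edges at `y`. -/
theorem HCov_of_rootEdge {V E : Type} [Fintype V] [DecidableEq V] [Fintype E] [DecidableEq E]
    {c : R} (hc : 0 ≤ c) {n : ℕ}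
    (ih : ∀ ends' : E → Sym2 V, nonLoopCard ends' < n → ∀ p' : E → R, IsProbVec p' →
      ∀ o a₁ a₂ a₃ b : V, a₁ ≠ a₂ → a₁ ≠ a₃ → a₂ ≠ a₃ → o ≠ a₁ → o ≠ a₂ → o ≠ a₃ → o ≠ b →
        b ≠ a₁ → b ≠ a₂ → b ≠ a₃ → HCov p' ends' o a₁ a₂ a₃ b)
    (ends : E → Sym2 V) (hn : nonLoopCard ends = n) (p : E → R) (hp : IsProbVec p)
    (o a₁ a₂ a₃ b : V) (h12 : a₁ ≠ a₂) (h13 : a₁ ≠ a₃) (h23 : a₂ ≠ a₃) (ho1 : o ≠ a₁)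
    (ho2 : o ≠ a₂) (ho3 : o ≠ a₃) (hob : o ≠ b) (hb1 : b ≠ a₁) (hb2 : b ≠ a₂) (hb3 : b ≠ a₃)
    (y : V) (e : E) (hy : Unmarked o a₁ a₂ a₃ b y) (he : ends e = s(a₁, y))
    (hcw : 2 ≤ (otherEdges ends e y).card → cCWAt c p ends o a₁ a₂ a₃ b e y) :
    HCov p ends o a₁ a₂ a₃ b := by
  have hay : a₁ ≠ y := hy.2.1.symm
  have hne : ¬ (ends e).IsDiag := by
    rw [he, Sym2.mk_isDiag_iff]
    exact hay
  have hlt1 : nonLoopCard (contractRootEdge ends a₁ y) < n :=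
    hn ▸ nonLoopCard_contract_lt ends hay he
  rcases Nat.lt_or_ge (otherEdges ends e y).card 2 with hlt | hge
  · have h01 : (otherEdges ends e y).card = 0 ∨ (otherEdges ends e y).card = 1 := by omega
    rcases h01 with h0 | h1
    · -- no other edge at `y`: the leaf rule
      have h0' : otherEdges ends e y = ∅ := Finset.card_eq_zero.mp h0
      have hleaf : ∀ g, g ≠ e → y ∈ ends g → (ends g).IsDiag := by
        intro g hge hyg
        by_contra hd
        have : g ∈ otherEdges ends e y := mem_otherEdges.mpr ⟨hge, hyg, hd⟩
        rw [h0'] at this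
        exact absurd this (Finset.notMem_empty g)
      unfold HCov
      rw [Gc_leaf p he hy hleaf]
      exact ih _ (hn ▸ nonLoopCard_update_loop_lt ends hne a₁) p hp o a₁ a₂ a₃ b h12 h13 h23 ho1
        ho2 ho3 hob hb1 hb2 hb3
    · -- exactly one other edge `f = {y, w}` at `y`: the series rule
      obtain ⟨f, hf⟩ := Finset.card_eq_one.mp h1
      have hfm : f ∈ otherEdges ends e y := by rw [hf]; exact Finset.mem_singleton_self f
      obtain ⟨hfe, hyf, hfd⟩ := mem_otherEdges.mp hfm
      obtain ⟨w, hw⟩ := Sym2.mem_iff_exists.mp hyf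
      have hyw : y ≠ w := by
        intro h
        rw [hw, Sym2.mk_isDiag_iff] at hfd
        exact hfd h
      have hdeg : ∀ g, g ≠ e → g ≠ f → y ∈ ends g → (ends g).IsDiag := by
        intro g hge hgf hyg
        by_contra hd
        have : g ∈ otherEdges ends e y := mem_otherEdges.mpr ⟨hge, hyg, hd⟩
        rw [hf, Finset.mem_singleton] at this
        exact hgf this
      unfold HCov
      rw [Gc_series p he hw hfe.symm hyw hy hdeg]
      have hp' : IsProbVec (Function.update (Function.update p f (p e * p f)) e 0) :=
        (hp.update f (mul_nonneg (hp.nonneg e) (hp.nonneg f))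
          (mul_le_one₀ (hp.le_one e) (hp.nonneg f) (hp.le_one f))).update e le_rfl zero_le_one
      exact ih _ hlt1 _ hp' o a₁ a₂ a₃ b h12 h13 h23 ho1 ho2 ho3 hob hb1 hb2 hb3
  · -- at least two other edges at `y`: (c-CW) with the deletion and the contraction
    exact HCov_of_cCWAt hc p hp he hy ho1 h12 h13 hb1 (hcw hge)
      (ih _ (hn ▸ nonLoopCard_update_loop_lt ends hne y) p hp o a₁ a₂ a₃ b h12 h13 h23 ho1 ho2 ho3
        hob hb1 hb2 hb3)
      (ih _ hlt1 p hp o a₁ a₂ a₃ b h12 h13 h23 ho1 ho2 ho3 hob hb1 hb2 hb3)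

/-- **The reduction to the reduced class of simple graphs**, by strong induction on the number of
non-loop edges: parallel edges are merged first, then a root edge to an unmarked vertex is treated
by the leaf / series rules or (c-CW), else the graph is in class R. -/
theorem HCov_of_cCWRedS_of_base {V E : Type} [Fintype V] [DecidableEq V] [Fintype E] [DecidableEq E]
    {c : R} (hc : 0 ≤ c) (hCW : cCWRedS_all R c) (hB : HCovR_all R) (n : ℕ) :
    ∀ (ends : E → Sym2 V), nonLoopCard ends = n → ∀ (p : E → R), IsProbVec p →
      ∀ o a₁ a₂ a₃ b : V, a₁ ≠ a₂ → a₁ ≠ a₃ → a₂ ≠ a₃ → o ≠ a₁ → o ≠ a₂ → o ≠ a₃ → o ≠ b →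
        b ≠ a₁ → b ≠ a₂ → b ≠ a₃ → HCov p ends o a₁ a₂ a₃ b := by
  induction n using Nat.strong_induction_on with
  | _ n ih =>
  intro ends hn p hp o a₁ a₂ a₃ b h12 h13 h23 ho1 ho2 ho3 hob hb1 hb2 hb3
  have ih' : ∀ ends' : E → Sym2 V, nonLoopCard ends' < n → ∀ p' : E → R, IsProbVec p' →
      ∀ o a₁ a₂ a₃ b : V, a₁ ≠ a₂ → a₁ ≠ a₃ → a₂ ≠ a₃ → o ≠ a₁ → o ≠ a₂ → o ≠ a₃ → o ≠ b →
        b ≠ a₁ → b ≠ a₂ → b ≠ a₃ → HCov p' ends' o a₁ a₂ a₃ b :=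
    fun ends' hlt p' hp' => ih _ hlt ends' rfl p' hp'
  by_cases hsimp : Simple ends
  · by_cases h1 : ∃ (e : E) (y : V), Unmarked o a₁ a₂ a₃ b y ∧ ends e = s(a₁, y)
    · obtain ⟨e, y, hy, he⟩ := h1
      exact HCov_of_rootEdge hc ih' ends hn p hp o a₁ a₂ a₃ b h12 h13 h23 ho1 ho2 ho3 hob hb1
        hb2 hb3 y e hy he
        (hCW V E ends hsimp p hp o a₁ a₂ a₃ b h12 h13 h23 ho1 ho2 ho3 hob hb1 hb2 hb3 y e hy he)
    · by_cases h2 : ∃ (e : E) (y : V), Unmarked o a₁ a₂ a₃ b y ∧ ends e = s(a₂, y)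
      · obtain ⟨e, y, hy, he⟩ := h2
        have hy' : Unmarked o a₂ a₁ a₃ b y := ⟨hy.1, hy.2.2.1, hy.2.1, hy.2.2.2.1, hy.2.2.2.2⟩
        have key := HCov_of_rootEdge hc ih' ends hn p hp o a₂ a₁ a₃ b h12.symm h23 h13 ho2 ho1
          ho3 hob hb2 hb1 hb3 y e hy' he
          (hCW V E ends hsimp p hp o a₂ a₁ a₃ b h12.symm h23 h13 ho2 ho1 ho3 hob hb2 hb1 hb3 y e
            hy' he)
        unfold HCov at key ⊢
        rwa [Gc_swap] at key
      · apply hB V E ends p hp o a₁ a₂ a₃ b h12 h13 h23 ho1 ho2 ho3 hob hb1 hb2 hb3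
        intro f hroot z hz
        rcases hroot with hf | hf
        · obtain ⟨y, hy⟩ := Sym2.mem_iff_exists.mp hf
          rw [hy] at hz
          rcases Sym2.mem_iff.mp hz with hz1 | hz2
          · rw [hz1]
            simp
          · rw [hz2]
            by_contra hzm
            push Not at hzm
            exact h1 ⟨f, y, hzm, hy⟩
        · obtain ⟨y, hy⟩ := Sym2.mem_iff_exists.mp hf
          rw [hy] at hz
          rcases Sym2.mem_iff.mp hz with hz1 | hz2
          · rw [hz1]
            simp
          · rw [hz2]
            by_contra hzm
            push Not at hzm
            exact h2 ⟨f, y, hzm, hy⟩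
  · -- two parallel non-loop edges: merge them
    unfold Simple at hsimp
    push Not at hsimp
    obtain ⟨g₁, g₂, hg12, hnd, hpar⟩ := hsimp
    obtain ⟨u, v, huv⟩ : ∃ u v, ends g₁ = s(u, v) :=
      (Sym2.exists (f := fun t => ends g₁ = t)).1 ⟨ends g₁, rfl⟩
    have hnd2 : ¬ (ends g₂).IsDiag := by rw [← hpar]; exact hnd
    have hlt : nonLoopCard (Function.update ends g₂ s(u, u)) < n :=
      hn ▸ nonLoopCard_update_loop_lt ends hnd2 u
    have hs1 := hp.nonneg g₁
    have hs2 := hp.nonneg g₂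
    have hs1' := hp.le_one g₁
    have hs2' := hp.le_one g₂
    have hp' : IsProbVec (Function.update (Function.update p g₁ (p g₁ + p g₂ - p g₁ * p g₂)) g₂ 0) :=
      (hp.update g₁ (by nlinarith) (by nlinarith)).update g₂ le_rfl zero_le_one
    unfold HCov
    rw [Gc_parallel p hg12 hpar.symm u o a₁ a₂ a₃ b]
    exact ih' _ hlt _ hp' o a₁ a₂ a₃ b h12 h13 h23 ho1 ho2 ho3 hob hb1 hb2 hb3

/-- **THE (root) RESIDUAL MAP, WEIGHTED, ON THE REDUCED CLASS OF SIMPLE GRAPHS**: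
`0 ≤ c → cCWRedS_all c → HCovR_all → HCov_all` — (HCOV) for every finite weighted (multi)graph from
(c-CW) at the root edges `e = {a₁, y}` of SIMPLE graphs whose unmarked end has degree ≥ 3, together
with (HCOV) on class R; parallel edges, unmarked leaves at the root and degree-two root neighbours
are removed by the parallel, leaf and series rules. -/
theorem HCov_all_of_cCWRedS_all {c : R} (hc : 0 ≤ c) (hCW : cCWRedS_all R c) (hB : HCovR_all R) :
    HCov_all R := by
  intro V E _ _ _ _ ends p hp o a₁ a₂ a₃ b h12 h13 h23 ho1 ho2 ho3 hob hb1 hb2 hb3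
  exact HCov_of_cCWRedS_of_base hc hCW hB _ ends rfl p hp o a₁ a₂ a₃ b h12 h13 h23 ho1 ho2 ho3 hob
    hb1 hb2 hb3

/-- The reduced-class reduction without the simplicity restriction. -/
theorem HCov_all_of_cCWRed_all {c : R} (hc : 0 ≤ c) (hCW : cCWRed_all R c) (hB : HCovR_all R) :
    HCov_all R :=
  HCov_all_of_cCWRedS_all hc (cCWRedS_all_of_cCWRed_all hCW) hB

end Main

end RECM

end Summit.Ventures.PercRepro2
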